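import Mathlib
import Summits.Ventures.PercRepro2.Defs
import Summits.Ventures.PercRepro2.Graph
import Summits.Ventures.PercRepro2.OneColourSwitch
import Summits.Ventures.PercRepro2.RegionHubSign
import Summits.Ventures.PercRepro2.SideSwitch
import Summits.Ventures.PercRepro2.SideSwitchM9

/-!
# Harris on a pair of corners of the hypercube (blind cell PercRepro2, p3 g30, 2026-08-28;
`proofs/P3-HDR.md` §10)

The lane's Harris step (`SideSwitch.sum_mul_nonpos_of_monotone_antitone`) bounds `Σ_T D·S` over
the WHOLE hypercube `2^A` when `D` is increasing with total `0` and `S` decreasing.  The clean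
one-sided reached colourings of an `H`-fibre are not the whole cube but the union of two
**corners** — the subsets `T` with `T ∩ F = ∅` and those with `F ⊆ T`, for the set `F` of the
blocks joining `d` to `r` or `s` (`proofs/P3-HDR.md` §10) — so the step is needed on the corner
pair.  Proved here: the **two-layer Harris inequality** `sum_pair_mul_nonpos` (`f ≤ f'`
increasing, `g' ≤ g` decreasing on `2^{A'}`, `Σ (f + f') = 0` ⟹ `Σ (f g + f' g') ≤ 0`: two
applications of `harris_powerset` and `Σ f ≤ 0 ≤ Σ g − Σ g'`), the decomposition of the corner
pair into `2^{A ∖ F}` twice (`sum_corners_eq`) and the corner-pair Harris step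
`sum_corners_mul_nonpos`: for `D` increasing on `2^A`, `S` decreasing and `Σ_{corners} D = 0`,
`Σ_{corners} D·S ≤ 0`.  Own work; std axioms.
-/

namespace Summit.Ventures.PercRepro2

namespace SideSwitch

open Finset

variable {α : Type*} [DecidableEq α]

/-- **Two-layer Harris**: `f ≤ f'` increasing, `g' ≤ g` decreasing on the subsets of `A`,
`Σ (f + f') = 0` ⟹ `Σ (f g + f' g') ≤ 0`. -/
lemma sum_pair_mul_nonpos (A : Finset α) (f f' g g' : Finset α → ℤ)
    (hf : ∀ T T', T ⊆ T' → T' ⊆ A → f T ≤ f T') (hf' : ∀ T T', T ⊆ T' → T' ⊆ A → f' T ≤ f' T')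
    (hg : ∀ T T', T ⊆ T' → T' ⊆ A → g T' ≤ g T) (hg' : ∀ T T', T ⊆ T' → T' ⊆ A → g' T' ≤ g' T)
    (hff : ∀ T ⊆ A, f T ≤ f' T) (hgg : ∀ T ⊆ A, g' T ≤ g T)
    (h0 : ∑ T ∈ A.powerset, (f T + f' T) = 0) :
    ∑ T ∈ A.powerset, (f T * g T + f' T * g' T) ≤ 0 := by
  have hN : (0 : ℤ) < 2 ^ A.card := pow_pos two_pos _
  have h1 := harris_powerset A f (fun T => - g T) hf (fun T T' h1 h2 => by
    have := hg T T' h1 h2; linarith)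
  have h2 := harris_powerset A f' (fun T => - g' T) hf' (fun T T' h1 h2 => by
    have := hg' T T' h1 h2; linarith)
  simp only [Finset.sum_neg_distrib, mul_neg] at h1 h2
  -- `h1 : -(Σf)(Σg) ≤ -(2^n · Σ f g)`, `h2` likewise
  rw [Finset.sum_add_distrib] at h0
  have hfle : ∑ T ∈ A.powerset, f T ≤ ∑ T ∈ A.powerset, f' T :=
    Finset.sum_le_sum fun T hT => hff T (Finset.mem_powerset.1 hT)
  have hgle : ∑ T ∈ A.powerset, g' T ≤ ∑ T ∈ A.powerset, g T :=
    Finset.sum_le_sum fun T hT => hgg T (Finset.mem_powerset.1 hT)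
  have hf0 : ∑ T ∈ A.powerset, f T ≤ 0 := by linarith
  have hprod : (∑ T ∈ A.powerset, f T) * (∑ T ∈ A.powerset, g T - ∑ T ∈ A.powerset, g' T) ≤ 0 :=
    mul_nonpos_of_nonpos_of_nonneg hf0 (by linarith)
  have hf' : ∑ T ∈ A.powerset, f' T = - ∑ T ∈ A.powerset, f T := by linarith
  rw [Finset.sum_add_distrib]
  rw [hf'] at h2
  have key : 2 ^ A.card * (∑ T ∈ A.powerset, f T * g T + ∑ T ∈ A.powerset, f' T * g' T) ≤ 0 := by
    nlinarith [h1, h2, hprod]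
  by_contra hcon
  have hpos : 0 < ∑ T ∈ A.powerset, f T * g T + ∑ T ∈ A.powerset, f' T * g' T := lt_of_not_ge hcon
  have := mul_pos hN hpos
  linarith

/-- The corner pair of `F` in the hypercube of `A`: the subsets disjoint from `F` and those
containing `F`. -/
def corners (A F : Finset α) : Finset (Finset α) :=
  A.powerset.filter (fun T => F ∩ T = ∅ ∨ F ⊆ T)

/-- **The corner pair is `2^{A ∖ F}` twice**: a sum over it is a sum over `2^{A ∖ F}` of the
value at `T` plus the value at `T ∪ F`. -/
lemma sum_corners_eq (A F : Finset α) (hFA : F ⊆ A) (hF : F.Nonempty) (h : Finset α → ℤ) :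
    ∑ T ∈ corners A F, h T = ∑ T ∈ (A \ F).powerset, (h T + h (T ∪ F)) := by
  have hdisj : Disjoint ((A \ F).powerset) (((A \ F).powerset).image (fun T => T ∪ F)) := by
    rw [Finset.disjoint_left]
    intro T hT hT'
    obtain ⟨T', _, rfl⟩ := Finset.mem_image.1 hT'
    have hsub := Finset.mem_powerset.1 hT
    obtain ⟨x, hx⟩ := hF
    have : x ∈ T' ∪ F := Finset.mem_union_right _ hx
    have := Finset.mem_sdiff.1 (hsub this)
    exact this.2 hx
  have hunion : corners A F = (A \ F).powerset ∪ ((A \ F).powerset).image (fun T => T ∪ F) := by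
    ext T
    simp only [corners, Finset.mem_filter, Finset.mem_powerset, Finset.mem_union, Finset.mem_image]
    constructor
    · rintro ⟨hTA, hc | hc⟩
      · left
        intro x hx
        exact Finset.mem_sdiff.2 ⟨hTA hx, fun hxF => by
          have : x ∈ F ∩ T := Finset.mem_inter.2 ⟨hxF, hx⟩
          rw [hc] at this; exact absurd this (Finset.notMem_empty x)⟩
      · right
        refine ⟨T \ F, ?_, ?_⟩
        · intro x hx
          obtain ⟨hxT, hxF⟩ := Finset.mem_sdiff.1 hx
          exact Finset.mem_sdiff.2 ⟨hTA hxT, hxF⟩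
        · ext x
          simp only [Finset.mem_union, Finset.mem_sdiff]
          constructor
          · rintro (⟨h1, _⟩ | h1)
            · exact h1
            · exact hc h1
          · intro hxT
            by_cases hxF : x ∈ F
            · exact Or.inr hxF
            · exact Or.inl ⟨hxT, hxF⟩
    · rintro (hT | ⟨T', hT', rfl⟩)
      · refine ⟨fun x hx => (Finset.mem_sdiff.1 (hT hx)).1, Or.inl ?_⟩
        ext x
        simp only [Finset.mem_inter, Finset.notMem_empty, iff_false, not_and]
        intro hxF hxT
        exact (Finset.mem_sdiff.1 (hT hxT)).2 hxF
      · refine ⟨?_, Or.inr Finset.subset_union_right⟩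
        intro x hx
        rcases Finset.mem_union.1 hx with hx | hx
        · exact (Finset.mem_sdiff.1 (hT' hx)).1
        · exact hFA hx
  have hinj : Set.InjOn (fun T : Finset α => T ∪ F) ↑((A \ F).powerset) := by
    intro T hT T' hT' heq
    have hT1 := Finset.mem_powerset.1 (Finset.mem_coe.1 hT)
    have hT2 := Finset.mem_powerset.1 (Finset.mem_coe.1 hT')
    ext x
    constructor
    · intro hx
      have hxF : x ∉ F := (Finset.mem_sdiff.1 (hT1 hx)).2
      have : x ∈ T' ∪ F := by
        have h : x ∈ T ∪ F := Finset.mem_union_left _ hx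
        simpa [heq] using h
      rcases Finset.mem_union.1 this with h | h
      · exact h
      · exact absurd h hxF
    · intro hx
      have hxF : x ∉ F := (Finset.mem_sdiff.1 (hT2 hx)).2
      have : x ∈ T ∪ F := by
        have h : x ∈ T' ∪ F := Finset.mem_union_left _ hx
        simpa [heq] using h
      rcases Finset.mem_union.1 this with h | h
      · exact h
      · exact absurd h hxF
  rw [hunion, Finset.sum_union hdisj, Finset.sum_image hinj, Finset.sum_add_distrib]

/-- **The Harris step on a corner pair**: `D` increasing on `2^A`, `S` decreasing,
`Σ_{corners} D = 0` ⟹ `Σ_{corners} D·S ≤ 0`. -/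
theorem sum_corners_mul_nonpos (A F : Finset α) (hFA : F ⊆ A) (hF : F.Nonempty)
    (D S : Finset α → ℤ)
    (hD : ∀ T T', T ⊆ T' → T' ⊆ A → D T ≤ D T') (hS : ∀ T T', T ⊆ T' → T' ⊆ A → S T' ≤ S T)
    (h0 : ∑ T ∈ corners A F, D T = 0) : ∑ T ∈ corners A F, D T * S T ≤ 0 := by
  rw [sum_corners_eq A F hFA hF] at h0 ⊢
  have hsubA : ∀ T, T ⊆ A \ F → T ⊆ A := fun T hT x hx => (Finset.mem_sdiff.1 (hT hx)).1
  have hsubA' : ∀ T, T ⊆ A \ F → T ∪ F ⊆ A := fun T hT => Finset.union_subset (hsubA T hT) hFA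
  refine sum_pair_mul_nonpos (A \ F) D (fun T => D (T ∪ F)) S (fun T => S (T ∪ F))
    (fun T T' h1 h2 => hD T T' h1 (hsubA T' h2))
    (fun T T' h1 h2 => hD (T ∪ F) (T' ∪ F) (Finset.union_subset_union h1 le_rfl) (hsubA' T' h2))
    (fun T T' h1 h2 => hS T T' h1 (hsubA T' h2))
    (fun T T' h1 h2 => hS (T ∪ F) (T' ∪ F) (Finset.union_subset_union h1 le_rfl) (hsubA' T' h2))
    (fun T hT => hD T (T ∪ F) Finset.subset_union_left (hsubA' T hT))
    (fun T hT => hS T (T ∪ F) Finset.subset_union_left (hsubA' T hT)) h0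

end SideSwitch

end Summit.Ventures.PercRepro2
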